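import Summits.QuantumFields.YangMills.Theorems.ToronSmallBallOwnAxisShiftLocal
import Mathlib.Analysis.SpecialFunctions.Trigonometric.Inverse
import HarnessLib

/-!
# The own-axis sheet shift: the class angle of an `SU(2)` element, chart shells, and the strip-separation inequality

Support module (`--supports` stmt-QuantumFields-24089, `ToronSmallBall.PeriodicOffCoreStripWindowDeep`; seat ym-dw-p1 g15).  Bookkeeping of the CLASS
ANGLE `r(W) = arccos (re q_W) ∈ [0, π]` (`q = su2Quat`) against the objects of the own-axis translate argument:

* §1 `expPoint_arccos_smul_axisVec : exp(ι (r(W) · axis W)) = W` for non-central `W` (`sin r(W) = ‖Im q_W‖`), hence the chart-shell membership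
  `mem_image_expPoint_shell_of_le_norm_imVec`: `σ ≤ ‖Im q_W‖` puts `W` in `exp(ι{arcsin σ ≤ ‖x‖ ≤ π − arcsin σ})` (the shell of the Jacobian lemma);
* §2 the distance to the centre through the angle: `vacDist W ² = 4 − 4|cos r(W)|`, `‖Im q_W‖ ≥ vacDist W / 2` (off-core ⇒ non-central);
* §3 the own-axis shift adds `θ` to the angle: `re q(classShift θ W) = cos(r(W) + θ)` and `vacDist (classShift θ W)² = 4 − 4|cos(r(W)+θ)|`;
* §4 ★ STRIP SEPARATION: on each hemisphere the map `r ↦ √(4 − 4|cos r|)` (the distance to the centre as a function of the angle) moves at speed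
  `≥ 1/2`: `|Δ√(4−4|cos|)| ≥ |Δr|/2` for `r, r' ∈ [0, π/2]` and for `r, r' ∈ [π/2, π]` — so a strip of `vacDist`-width `w` has angular width `≤ 4w`
  on each hemisphere, and angular translates by multiples of `5w` are pairwise disjoint.

HONEST FRAMING: trigonometry on one compact group; nothing about infinite volume, the continuum limit or the Clay gap.  No `sorry`, no new axiom, no
new definition.  References: [folklore]; [cite: Luscher1983, §2] (where the bookkeeping is used).
-/

set_option autoImplicit false

noncomputable section

open scoped Quaternion
open NormedSpace Real
open Literature.MathematicalPhysics.QuantumLattice (su2Quat su2Quat_ne_zero norm_su2Quat quatToSU2 quatToSU2_su2Quat)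
open Literature.MathematicalPhysics.QuantumFieldTheory.Balaban1983to89.T4HaarSU2ExpChart

namespace Summit.QuantumFields.YangMills.Theorems.FemtoTransferGap.OwnAxis

open ClassShift

/-! ## §1 The class angle and the chart shell -/

/-- `‖Im q‖² = 1 − (re q)²` for a unit quaternion. [folklore] -/
theorem norm_imVec_sq_eq (W : Matrix.specialUnitaryGroup (Fin 2) ℂ) : ‖imVec (su2Quat W)‖ ^ 2 = 1 - (su2Quat W).re ^ 2 := by
  have h1 : ‖su2Quat W‖ ^ 2 = (su2Quat W).re ^ 2 + (su2Quat W).imI ^ 2 + (su2Quat W).imJ ^ 2 + (su2Quat W).imK ^ 2 := by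
    rw [sq, ← Quaternion.normSq_eq_norm_mul_self, Quaternion.normSq_def']
  have h2 : ‖imVec (su2Quat W)‖ ^ 2 = (su2Quat W).imI ^ 2 + (su2Quat W).imJ ^ 2 + (su2Quat W).imK ^ 2 := by
    rw [EuclideanSpace.real_norm_sq_eq, Fin.sum_univ_three]
    simp [imVec]
  rw [norm_su2Quat] at h1
  linarith

/-- `−1 ≤ re q_W ≤ 1` for `W ∈ SU(2)` (tree: `BalabanUV.InfraRed.StrongCouplingSixFifthsMoments.abs_re_su2Quat_le_one`, restated as a pair to
keep that import out). [folklore] -/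
theorem re_su2Quat_mem_Icc (W : Matrix.specialUnitaryGroup (Fin 2) ℂ) : -1 ≤ (su2Quat W).re ∧ (su2Quat W).re ≤ 1 := by
  have h := norm_imVec_sq_eq W
  have h0 : 0 ≤ ‖imVec (su2Quat W)‖ ^ 2 := sq_nonneg _
  have h1 : |(su2Quat W).re| ≤ 1 := abs_le_one_iff_mul_self_le_one.2 (by nlinarith)
  exact abs_le.1 h1

/-- `sin(arccos(re q_W)) = ‖Im q_W‖`. [folklore] -/
theorem sin_arccos_re_eq (W : Matrix.specialUnitaryGroup (Fin 2) ℂ) : Real.sin (Real.arccos (su2Quat W).re) = ‖imVec (su2Quat W)‖ := by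
  rw [Real.sin_arccos, ← norm_imVec_sq_eq, Real.sqrt_sq (norm_nonneg _)]

/-- ★ **Polar form**: `exp(ι(arccos(re q_W) · axis W)) = W` for every non-central `W`. [folklore] -/
theorem expPoint_arccos_smul_axisVec {W : Matrix.specialUnitaryGroup (Fin 2) ℂ} (hW : imVec (su2Quat W) ≠ 0) :
    expPoint (Real.arccos (su2Quat W).re • axisVec W) = W := by
  -- `su2Quat` is injective (tree: `BalabanUV.InfraRed.StrongCouplingLipschitzFlux.su2Quat_injective`; one line keeps that import out)
  refine (fun {A B : Matrix.specialUnitaryGroup (Fin 2) ℂ} (h : su2Quat A = su2Quat B) => show A = B by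
    rw [← quatToSU2_su2Quat A, ← quatToSU2_su2Quat B, h]) ?_
  rw [su2Quat_expPoint_axisVec _ hW, sin_arccos_re_eq, Real.cos_arccos (re_su2Quat_mem_Icc W).1 (re_su2Quat_mem_Icc W).2]
  unfold axisVec
  rw [map_smul, smul_smul, mul_inv_cancel₀ (norm_ne_zero_iff.2 hW), one_smul]
  have himv : imQuat (imVec (su2Quat W)) = (su2Quat W).im := by ext <;> simp [imQuat_apply, imVec, Quaternion.im]
  rw [himv, Quaternion.re_add_im]

/-- The class angle of an element with `‖Im q‖ ≥ σ` lies in `[arcsin σ, π − arcsin σ]`. [folklore] -/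
theorem arccos_re_mem_of_le_norm_imVec {σ : ℝ} {W : Matrix.specialUnitaryGroup (Fin 2) ℂ} (hσW : σ ≤ ‖imVec (su2Quat W)‖) :
    Real.arcsin σ ≤ Real.arccos (su2Quat W).re ∧ Real.arccos (su2Quat W).re ≤ π - Real.arcsin σ := by
  set r := Real.arccos (su2Quat W).re with hr
  have hr0 : 0 ≤ r := Real.arccos_nonneg _
  have hrπ : r ≤ π := Real.arccos_le_pi _
  have hsin : σ ≤ Real.sin r := by rw [hr, sin_arccos_re_eq]; exact hσW
  have key : ∀ s : ℝ, 0 ≤ s → s ≤ π → σ ≤ Real.sin s → Real.arcsin σ ≤ s := by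
    intro s hs0 hsπ hσs
    by_cases hs : s ≤ π / 2
    · calc Real.arcsin σ ≤ Real.arcsin (Real.sin s) := Real.arcsin_le_arcsin hσs
        _ = s := Real.arcsin_sin (by linarith) hs
    · exact (Real.arcsin_le_pi_div_two σ).trans (le_of_lt (not_le.1 hs))
  refine ⟨key r hr0 hrπ hsin, ?_⟩
  have h2 := key (π - r) (by linarith) (by linarith) (by rw [Real.sin_pi_sub]; exact hsin)
  linarith

/-- ★ **Shell membership**: `σ ≤ ‖Im q_W‖` with `0 < σ` puts `W` in the chart shell `exp(ι{arcsin σ ≤ ‖x‖ ≤ π − arcsin σ})`. [folklore] -/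
theorem mem_image_expPoint_shell_of_le_norm_imVec {σ : ℝ} (hσ : 0 < σ) {W : Matrix.specialUnitaryGroup (Fin 2) ℂ} (hσW : σ ≤ ‖imVec (su2Quat W)‖) :
    W ∈ expPoint '' {v : EuclideanSpace ℝ (Fin 3) | Real.arcsin σ ≤ ‖v‖ ∧ ‖v‖ ≤ π - Real.arcsin σ} := by
  have hW : imVec (su2Quat W) ≠ 0 := fun h => by rw [h, norm_zero] at hσW; linarith
  refine ⟨Real.arccos (su2Quat W).re • axisVec W, ?_, expPoint_arccos_smul_axisVec hW⟩
  have hnorm : ‖Real.arccos (su2Quat W).re • axisVec W‖ = Real.arccos (su2Quat W).re := by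
    rw [norm_smul, norm_axisVec_eq_one hW, mul_one, Real.norm_of_nonneg (Real.arccos_nonneg _)]
  simp only [Set.mem_setOf_eq, hnorm]
  exact arccos_re_mem_of_le_norm_imVec hσW

/-! ## §2 The distance to the centre through the angle -/

/-- `vacDist W² = 4 − 4|re q_W|`. [folklore] -/
theorem vacDist_sq_eq_re (W : Matrix.specialUnitaryGroup (Fin 2) ℂ) : vacDist W ^ 2 = 4 - 4 * |(su2Quat W).re| := by
  have hre : ((W : Matrix (Fin 2) (Fin 2) ℂ).trace).re = 2 * (su2Quat W).re := by
    rw [← Literature.MathematicalPhysics.QuantumLattice.quatMatrix_su2Quat W]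
    exact Literature.MathematicalPhysics.QuantumLattice.trace_quatMatrix_re _
  rw [vacDist_sq_eq, hre, abs_mul, abs_of_pos (by norm_num : (0 : ℝ) < 2)]
  ring

/-- `vacDist W = √(4 − 4|cos(arccos(re q_W))|)` — the distance to the centre is a function of the class angle. [folklore] -/
theorem vacDist_eq_sqrt_angle (W : Matrix.specialUnitaryGroup (Fin 2) ℂ) :
    vacDist W = Real.sqrt (4 - 4 * |Real.cos (Real.arccos (su2Quat W).re)|) := by
  rw [Real.cos_arccos (re_su2Quat_mem_Icc W).1 (re_su2Quat_mem_Icc W).2, ← vacDist_sq_eq_re,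
    Real.sqrt_sq (vacDist_nonneg _)]

/-- ★ **Off the core ⇒ non-central, quantitatively**: `vacDist W / 2 ≤ ‖Im q_W‖`. [folklore] -/
theorem half_vacDist_le_norm_imVec (W : Matrix.specialUnitaryGroup (Fin 2) ℂ) : vacDist W / 2 ≤ ‖imVec (su2Quat W)‖ := by
  have h1 := norm_imVec_sq_eq W
  have h2 := vacDist_sq_eq_re W
  have hre : |(su2Quat W).re| ≤ 1 := abs_le.2 (re_su2Quat_mem_Icc W)
  have hv0 := vacDist_nonneg W
  have hi0 : 0 ≤ ‖imVec (su2Quat W)‖ := norm_nonneg _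
  -- `‖Im‖² = (1 − |re|)(1 + |re|) ≥ 1 − |re| = vacDist²/4`
  have hsq : (vacDist W / 2) ^ 2 ≤ ‖imVec (su2Quat W)‖ ^ 2 := by
    have habs : (su2Quat W).re ^ 2 = |(su2Quat W).re| ^ 2 := (sq_abs _).symm
    rw [h1, habs]
    nlinarith [abs_nonneg (su2Quat W).re]
  exact (pow_le_pow_iff_left₀ (by positivity) hi0 two_ne_zero).1 hsq

/-! ## §3 The own-axis shift adds `θ` to the class angle -/

/-- `classShift θ W = exp(ι((arccos(re q_W) + θ) · axis W))` for non-central `W`. [folklore] -/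
theorem classShift_eq_expPoint {W : Matrix.specialUnitaryGroup (Fin 2) ℂ} (hW : imVec (su2Quat W) ≠ 0) (θ : ℝ) :
    classShift θ W = expPoint ((Real.arccos (su2Quat W).re + θ) • axisVec W) := by
  have hsin : 0 < Real.sin (Real.arccos (su2Quat W).re) := by rw [sin_arccos_re_eq]; exact norm_pos_iff.2 hW
  conv_lhs => rw [← expPoint_arccos_smul_axisVec hW]
  exact classShift_expPoint_smul (norm_axisVec_eq_one hW) hsin θ

/-- ★ `re q(classShift θ W) = cos(arccos(re q_W) + θ)`. [folklore] -/
theorem re_su2Quat_classShift {W : Matrix.specialUnitaryGroup (Fin 2) ℂ} (hW : imVec (su2Quat W) ≠ 0) (θ : ℝ) :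
    (su2Quat (classShift θ W)).re = Real.cos (Real.arccos (su2Quat W).re + θ) := by
  rw [classShift_eq_expPoint hW, su2Quat_expPoint, exp_imQuat_re, norm_smul, norm_axisVec_eq_one hW, mul_one, Real.norm_eq_abs, Real.cos_abs]

/-- The angle after the shift, when it stays in `[0, π]`: `arccos(re q(classShift θ W)) = arccos(re q_W) + θ`. [folklore] -/
theorem arccos_re_classShift {W : Matrix.specialUnitaryGroup (Fin 2) ℂ} (hW : imVec (su2Quat W) ≠ 0) {θ : ℝ}
    (h0 : 0 ≤ Real.arccos (su2Quat W).re + θ) (hπ : Real.arccos (su2Quat W).re + θ ≤ π) :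
    Real.arccos (su2Quat (classShift θ W)).re = Real.arccos (su2Quat W).re + θ := by
  rw [re_su2Quat_classShift hW, Real.arccos_cos h0 hπ]

/-- ★ The distance to the centre after the shift: `vacDist (classShift θ W)² = 4 − 4|cos(arccos(re q_W) + θ)|`. [folklore] -/
theorem vacDist_classShift_sq {W : Matrix.specialUnitaryGroup (Fin 2) ℂ} (hW : imVec (su2Quat W) ≠ 0) (θ : ℝ) :
    vacDist (classShift θ W) ^ 2 = 4 - 4 * |Real.cos (Real.arccos (su2Quat W).re + θ)| := by
  rw [classShift_eq_expPoint hW, vacDist_expPoint_sq, norm_smul, norm_axisVec_eq_one hW, mul_one, Real.norm_eq_abs, Real.cos_abs]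

/-- `vacDist (classShift θ W) = √(4 − 4|cos(arccos(re q_W) + θ)|)`. [folklore] -/
theorem vacDist_classShift_eq_sqrt {W : Matrix.specialUnitaryGroup (Fin 2) ℂ} (hW : imVec (su2Quat W) ≠ 0) (θ : ℝ) :
    vacDist (classShift θ W) = Real.sqrt (4 - 4 * |Real.cos (Real.arccos (su2Quat W).re + θ)|) := by
  rw [← vacDist_classShift_sq hW, Real.sqrt_sq (vacDist_nonneg _)]

/-! ## §4 Strip separation: the distance to the centre moves at speed `≥ 1/2` in the angle, on each hemisphere -/

/-- `√(4 − 4 cos r) = 2√2 sin(r/2)` on `[0, π]`. [folklore] -/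
theorem sqrt_four_sub_four_cos {r : ℝ} (h0 : 0 ≤ r) (hπ : r ≤ π) : Real.sqrt (4 - 4 * Real.cos r) = 2 * Real.sqrt 2 * Real.sin (r / 2) := by
  rw [Real.sin_half_eq_sqrt h0 (by linarith [Real.pi_pos]), ← Real.sqrt_mul_self (by positivity : (0 : ℝ) ≤ 2 * Real.sqrt 2), ← Real.sqrt_mul (by positivity)]
  congr 1
  have h2 : Real.sqrt 2 * Real.sqrt 2 = 2 := Real.mul_self_sqrt (by norm_num)
  rw [show (2 * Real.sqrt 2) * (2 * Real.sqrt 2) = 4 * (Real.sqrt 2 * Real.sqrt 2) by ring, h2]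
  ring

/-- `√(4 + 4 cos r) = 2√2 cos(r/2)` on `[0, π]`. [folklore] -/
theorem sqrt_four_add_four_cos {r : ℝ} (h0 : 0 ≤ r) (hπ : r ≤ π) : Real.sqrt (4 + 4 * Real.cos r) = 2 * Real.sqrt 2 * Real.cos (r / 2) := by
  have hc : Real.cos (r / 2) = Real.sqrt ((1 + Real.cos r) / 2) := by
    rw [Real.cos_half (by linarith [Real.pi_pos]) hπ]
  rw [hc, ← Real.sqrt_mul_self (by positivity : (0 : ℝ) ≤ 2 * Real.sqrt 2), ← Real.sqrt_mul (by positivity)]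
  congr 1
  have h2 : Real.sqrt 2 * Real.sqrt 2 = 2 := Real.mul_self_sqrt (by norm_num)
  rw [show (2 * Real.sqrt 2) * (2 * Real.sqrt 2) = 4 * (Real.sqrt 2 * Real.sqrt 2) by ring, h2]
  ring

/-- Jordan on a quarter: `sin(d/4) ≥ d/(2π)` for `0 ≤ d ≤ π/2·… ≤ 2π`. [folklore] -/
theorem sin_quarter_ge {d : ℝ} (h0 : 0 ≤ d) (hd : d ≤ 2 * π) : d / (2 * π) ≤ Real.sin (d / 4) := by
  have h := Real.mul_le_sin (x := d / 4) (by positivity) (by linarith)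
  have hπ := Real.pi_pos
  calc d / (2 * π) = 2 / π * (d / 4) := by field_simp; ring
    _ ≤ Real.sin (d / 4) := h

/-- ★ **Lower hemisphere**: for `0 ≤ r ≤ r' ≤ π/2`, `√(4 − 4|cos r'|) − √(4 − 4|cos r|) ≥ (r' − r)/2`. [folklore] -/
theorem sqrt_vac_sub_ge_lower {r r' : ℝ} (h0 : 0 ≤ r) (hrr : r ≤ r') (h' : r' ≤ π / 2) :
    (r' - r) / 2 ≤ Real.sqrt (4 - 4 * |Real.cos r'|) - Real.sqrt (4 - 4 * |Real.cos r|) := by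
  have hπ := Real.pi_pos
  have hc : 0 ≤ Real.cos r := Real.cos_nonneg_of_neg_pi_div_two_le_of_le (by linarith) (by linarith)
  have hc' : 0 ≤ Real.cos r' := Real.cos_nonneg_of_neg_pi_div_two_le_of_le (by linarith) (by linarith)
  rw [abs_of_nonneg hc, abs_of_nonneg hc', sqrt_four_sub_four_cos h0 (by linarith), sqrt_four_sub_four_cos (by linarith) (by linarith),
    ← mul_sub, Real.sin_sub_sin]
  -- `2√2 · 2 sin((r'-r)/4) cos((r'+r)/4) ≥ 2√2 · 2 · (r'-r)/(2π) · (√2/2)`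
  have hs : (r' - r) / (2 * π) ≤ Real.sin ((r' / 2 - r / 2) / 2) := by
    rw [show (r' / 2 - r / 2) / 2 = (r' - r) / 4 by ring]; exact sin_quarter_ge (by linarith) (by linarith)
  have hcos : Real.sqrt 2 / 2 ≤ Real.cos ((r' / 2 + r / 2) / 2) := by
    rw [← Real.cos_pi_div_four]
    exact Real.cos_le_cos_of_nonneg_of_le_pi (by linarith) (by linarith) (by linarith)
  have h2 : Real.sqrt 2 * Real.sqrt 2 = 2 := Real.mul_self_sqrt (by norm_num)
  have hs0 : 0 ≤ (r' - r) / (2 * π) := by positivity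
  have hsq0 : 0 ≤ Real.sqrt 2 / 2 := by positivity
  calc (r' - r) / 2 ≤ (4 / π) * ((r' - r) / 2) := by
        have : 1 ≤ 4 / π := by rw [le_div_iff₀ hπ]; linarith [Real.pi_le_four]
        nlinarith
    _ = 2 * Real.sqrt 2 * (2 * ((r' - r) / (2 * π)) * (Real.sqrt 2 / 2)) := by field_simp; nlinarith [h2]
    _ ≤ 2 * Real.sqrt 2 * (2 * Real.sin ((r' / 2 - r / 2) / 2) * Real.cos ((r' / 2 + r / 2) / 2)) := by
        have := mul_le_mul hs hcos hsq0 ((hs0).trans hs)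
        nlinarith [Real.sqrt_nonneg 2]

/-- ★ **Upper hemisphere**: for `π/2 ≤ r ≤ r' ≤ π`, `√(4 − 4|cos r|) − √(4 − 4|cos r'|) ≥ (r' − r)/2`. [folklore] -/
theorem sqrt_vac_sub_ge_upper {r r' : ℝ} (h0 : π / 2 ≤ r) (hrr : r ≤ r') (h' : r' ≤ π) :
    (r' - r) / 2 ≤ Real.sqrt (4 - 4 * |Real.cos r|) - Real.sqrt (4 - 4 * |Real.cos r'|) := by
  have hπ := Real.pi_pos
  have hc : Real.cos r ≤ 0 := Real.cos_nonpos_of_pi_div_two_le_of_le h0 (by linarith)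
  have hc' : Real.cos r' ≤ 0 := Real.cos_nonpos_of_pi_div_two_le_of_le (by linarith) (by linarith)
  rw [abs_of_nonpos hc, abs_of_nonpos hc', show 4 - 4 * -Real.cos r = 4 + 4 * Real.cos r by ring,
    show 4 - 4 * -Real.cos r' = 4 + 4 * Real.cos r' by ring, sqrt_four_add_four_cos (by linarith) (by linarith),
    sqrt_four_add_four_cos (by linarith) h', ← mul_sub, Real.cos_sub_cos]
  -- `cos(r/2) − cos(r'/2) = -2 sin((r+r')/4) sin((r-r')/4) = 2 sin((r+r')/4) sin((r'-r)/4)`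
  have hs : (r' - r) / (2 * π) ≤ Real.sin ((r' - r) / 4) := sin_quarter_ge (by linarith) (by linarith)
  have hsin : Real.sqrt 2 / 2 ≤ Real.sin ((r / 2 + r' / 2) / 2) := by
    rw [← Real.sin_pi_div_four]
    have h1 : π / 4 ≤ (r / 2 + r' / 2) / 2 := by linarith
    have h2 : (r / 2 + r' / 2) / 2 ≤ π / 2 := by linarith
    rw [← Real.cos_pi_div_two_sub, ← Real.cos_pi_div_two_sub ((r / 2 + r' / 2) / 2)]
    exact Real.cos_le_cos_of_nonneg_of_le_pi (by linarith) (by linarith) (by linarith)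
  have hneg : Real.sin ((r / 2 - r' / 2) / 2) = -Real.sin ((r' - r) / 4) := by
    rw [← Real.sin_neg]; congr 1; ring
  rw [hneg]
  have h2 : Real.sqrt 2 * Real.sqrt 2 = 2 := Real.mul_self_sqrt (by norm_num)
  have hs0 : 0 ≤ (r' - r) / (2 * π) := by positivity
  have hsq0 : 0 ≤ Real.sqrt 2 / 2 := by positivity
  calc (r' - r) / 2 ≤ (4 / π) * ((r' - r) / 2) := by
        have : 1 ≤ 4 / π := by rw [le_div_iff₀ hπ]; linarith [Real.pi_le_four]
        nlinarith
    _ = 2 * Real.sqrt 2 * (2 * (Real.sqrt 2 / 2) * ((r' - r) / (2 * π))) := by field_simp; nlinarith [h2]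
    _ ≤ 2 * Real.sqrt 2 * (-2 * Real.sin ((r / 2 + r' / 2) / 2) * -Real.sin ((r' - r) / 4)) := by
        have := mul_le_mul hsin hs hs0 (hsq0.trans hsin)
        nlinarith [Real.sqrt_nonneg 2]

/-- ★ **Strip separation**: two angles of the SAME hemisphere whose distances to the centre are both within `w` of one value `c` differ by at
most `4w`. [folklore] -/
theorem abs_sub_le_of_strip {r r' c w : ℝ}
    (hsame : (0 ≤ r ∧ r ≤ π / 2 ∧ 0 ≤ r' ∧ r' ≤ π / 2) ∨ (π / 2 ≤ r ∧ r ≤ π ∧ π / 2 ≤ r' ∧ r' ≤ π))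
    (hr : |Real.sqrt (4 - 4 * |Real.cos r|) - c| ≤ w) (hr' : |Real.sqrt (4 - 4 * |Real.cos r'|) - c| ≤ w) : |r - r'| ≤ 4 * w := by
  have hd : |Real.sqrt (4 - 4 * |Real.cos r|) - Real.sqrt (4 - 4 * |Real.cos r'|)| ≤ 2 * w := by
    have := abs_sub_le (Real.sqrt (4 - 4 * |Real.cos r|)) c (Real.sqrt (4 - 4 * |Real.cos r'|))
    rw [abs_sub_comm c] at this
    linarith
  rcases hsame with ⟨h0, h1, h0', h1'⟩ | ⟨h0, h1, h0', h1'⟩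
  · rcases le_total r r' with hle | hle
    · have h := sqrt_vac_sub_ge_lower h0 hle h1'
      rw [abs_sub_comm] at hd
      rw [abs_of_nonpos (by linarith)]
      linarith [(abs_le.1 hd).2]
    · have h := sqrt_vac_sub_ge_lower h0' hle h1
      rw [abs_of_nonneg (by linarith)]
      linarith [(abs_le.1 hd).2]
  · rcases le_total r r' with hle | hle
    · have h := sqrt_vac_sub_ge_upper h0 hle h1'
      rw [abs_of_nonpos (by linarith)]
      linarith [(abs_le.1 hd).2]
    · have h := sqrt_vac_sub_ge_upper h0' hle h1
      rw [abs_sub_comm] at hd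
      rw [abs_of_nonneg (by linarith)]
      linarith [(abs_le.1 hd).2]

end Summit.QuantumFields.YangMills.Theorems.FemtoTransferGap.OwnAxis

end
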